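import Mathlib.FieldTheory.AlgebraicClosure
import Mathlib.FieldTheory.Separable
import Mathlib.FieldTheory.Perfect
import Mathlib.RingTheory.Polynomial.GaussLemma
import Mathlib.RingTheory.LaurentSeries
import Mathlib.RingTheory.UniqueFactorizationDomain.Basic
import Mathlib.Analysis.Complex.Basic
import Mathlib.Analysis.Analytic.IsolatedZeros
import Mathlib.Analysis.Analytic.Constructions
import Mathlib.Analysis.SpecialFunctions.Complex.Analytic
import HarnessLib

/-!
# Puiseux germ of a real semialgebraic function — algebraic preliminaries and the vanishing factor

Auxiliary results for the real Puiseux germ (`stub_puiseuxGerm` of the sibling crux `CurvePeriodsTransfer`, the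
last input of `stub_arcSymbols` of line `nash-retraction-thin-strip` of crux `RealOnePeriodRelations`):

* `exists_polyK`: a real two-variable polynomial with algebraic coefficients, recentred at an algebraic abscissa
  `a`, is the complex evaluation `(t, W) ↦ P(a + t, W)` of some `Pk ∈ k[s][Y]` over `k = algebraicClosure ℚ ℂ`;
* `separable_map_laurent_of_irreducible`: an irreducible `Q ∈ k[s][Y]` of positive `Y`-degree is separable over
  the Laurent series field `k⸨s⸩` (Gauss's lemma, irreducible ⇒ separable in characteristic zero);
* `exists_irreducible_factor_vanishing` (registered anchor `helper_puiseuxGerm_1`): along an ANALYTIC real arc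
  `x ↦ (x − a, f x)` a non-zero `Pk ∈ K[s][Y]` has an irreducible factor of positive degree vanishing on the whole
  arc (identity principle on the connected interval).

References: J. Bochnak, M. Coste, M.-F. Roy, *Real Algebraic Geometry* (1998), §8.1; J. Kollár, *Lectures on
Resolution of Singularities* (2007), 1.94–1.95.
-/

noncomputable section

open Polynomial Filter Topology Set
open scoped RatFunc

namespace Summit.KontsevichZagierPeriods.SymplecticScissors.RealOnePeriodRelations

namespace PuiseuxGerm

/-- A real algebraic number, seen in `ℂ`, lies in `algebraicClosure ℚ ℂ`. [folklore] -/
theorem ofReal_mem_algebraicClosure {x : ℝ} (hx : IsAlgebraic ℚ x) :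
    ((x : ℂ)) ∈ algebraicClosure ℚ ℂ :=
  mem_algebraicClosure_iff.2 (hx.algebraMap (A := ℂ))

/-- Elements of `algebraicClosure ℚ ℂ` are algebraic complex numbers. [folklore] -/
theorem isAlgebraic_coe_algebraicClosure (x : algebraicClosure ℚ ℂ) : IsAlgebraic ℚ (x : ℂ) :=
  mem_algebraicClosure_iff.1 x.2

/-- **Recentred algebraic model over `k = algebraicClosure ℚ ℂ`.** For `P ∈ ℝ[x, y]` with algebraic
coefficients and an algebraic abscissa `a` there is `Pk ∈ k[s][Y]` whose complex evaluation at `(t, W)` is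
`P(a + t, W)`. [folklore] -/
theorem exists_polyK (P : MvPolynomial (Fin 2) ℝ) (hP : ∀ d, IsAlgebraic ℚ (P.coeff d)) {a : ℝ}
    (ha : IsAlgebraic ℚ a) :
    ∃ Pk : (algebraicClosure ℚ ℂ)[X][X], ∀ t W : ℂ,
      (Pk.map (eval₂RingHom (algebraMap (algebraicClosure ℚ ℂ) ℂ) t)).eval W =
        MvPolynomial.eval ![(a : ℂ) + t, W] (MvPolynomial.map (algebraMap ℝ ℂ) P) := by
  classical
  set k := algebraicClosure ℚ ℂ with hk
  set cK : (Fin 2 →₀ ℕ) → k := fun d => ⟨((P.coeff d : ℝ) : ℂ), ofReal_mem_algebraicClosure (hP d)⟩ with hcK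
  set aK : k := ⟨(a : ℂ), ofReal_mem_algebraicClosure ha⟩ with haK
  refine ⟨∑ d ∈ P.support, C (C (cK d) * (C aK + X) ^ (d 0)) * X ^ (d 1), fun t W => ?_⟩
  rw [MvPolynomial.eval_map, MvPolynomial.eval₂_eq', Polynomial.map_sum, eval_finsetSum]
  refine Finset.sum_congr rfl fun d _ => ?_
  rw [Polynomial.map_mul, Polynomial.map_pow, Polynomial.map_X, Polynomial.map_C, eval_mul, eval_pow,
    eval_X, eval_C, coe_eval₂RingHom, eval₂_mul, eval₂_C, eval₂_pow, eval₂_add, eval₂_C, eval₂_X,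
    Fin.prod_univ_two]
  simp only [Matrix.cons_val_zero, Matrix.cons_val_one]
  have h1 : algebraMap k ℂ (cK d) = ((P.coeff d : ℝ) : ℂ) := rfl
  have h2 : algebraMap k ℂ aK = (a : ℂ) := rfl
  rw [h1, h2, MvPolynomial.coeff, mul_assoc]
  rfl

/-- An irreducible polynomial of positive degree over a domain is primitive. [folklore] -/
theorem isPrimitive_of_irreducible {R : Type*} [CommRing R] [IsDomain R] {Q : R[X]} (hQ : Irreducible Q)
    (hdeg : 0 < Q.natDegree) : Q.IsPrimitive := by
  rw [isPrimitive_iff_isUnit_of_C_dvd]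
  intro r hr
  obtain ⟨Q', hQ'⟩ := hr
  have hr0 : r ≠ 0 := by
    rintro rfl
    rw [C_0, zero_mul] at hQ'
    rw [hQ', natDegree_zero] at hdeg
    exact lt_irrefl 0 hdeg
  rcases hQ.isUnit_or_isUnit hQ' with hu | hu
  · exact isUnit_C.1 hu
  · exfalso
    have hdegQ' : Q'.natDegree = 0 := natDegree_eq_zero_of_isUnit hu
    have : Q.natDegree = 0 := by
      rw [hQ', natDegree_C_mul hr0, hdegQ']
    omega

/-- **Irreducible ⇒ separable over the Laurent series field.** For a field `k` of characteristic zero, an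
irreducible `Q ∈ k[s][Y]` of positive `Y`-degree has separable image in `k⸨s⸩[Y]` (Gauss's lemma over the
GCD domain `k[s]`, irreducible ⇒ separable in characteristic zero, base change along `k(s) → k⸨s⸩`).
[folklore] -/
theorem separable_map_laurent_of_irreducible {k : Type} [Field k] [CharZero k] (Q : k[X][X])
    (hQ : Irreducible Q) (hdeg : 0 < Q.natDegree) :
    (Q.map ((HahnSeries.ofPowerSeries ℤ k).comp
      (Polynomial.coeToPowerSeries.ringHom : k[X] →+* PowerSeries k))).Separable := by
  have hprim : Q.IsPrimitive := isPrimitive_of_irreducible hQ hdeg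
  have hirrK : Irreducible (Q.map (algebraMap k[X] (RatFunc k))) :=
    (hprim.irreducible_iff_irreducible_map_fraction_map (K := RatFunc k)).1 hQ
  have hsepK : (Q.map (algebraMap k[X] (RatFunc k))).Separable := hirrK.separable
  have hhom : (HahnSeries.ofPowerSeries ℤ k).comp
      (Polynomial.coeToPowerSeries.ringHom : k[X] →+* PowerSeries k) =
      (algebraMap (RatFunc k) (LaurentSeries k)).comp (algebraMap k[X] (RatFunc k)) := by
    refine RingHom.ext fun p => ?_
    simp only [RingHom.comp_apply]
    have := RatFunc.coe_coe p
    exact this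
  rw [hhom, ← Polynomial.map_map]
  exact hsepK.map


variable {K : Type*} [Field K] [Algebra K ℂ]

/-! ### Analyticity of the evaluation along real-analytic arcs -/

/-- `x ↦ G(u x, v x)` (complex evaluation of `G ∈ K[s][Y]`) is real-analytic when `u, v : ℝ → ℂ` are.
[folklore] -/
theorem analyticAt_eval₂ (G : K[X][X]) {u v : ℝ → ℂ} {x : ℝ} (hu : AnalyticAt ℝ u x)
    (hv : AnalyticAt ℝ v x) :
    AnalyticAt ℝ (fun y => (G.map (eval₂RingHom (algebraMap K ℂ) (u y))).eval (v y)) x := by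
  have hfun : (fun y => (G.map (eval₂RingHom (algebraMap K ℂ) (u y))).eval (v y)) = fun y =>
      ∑ i ∈ Finset.range (G.natDegree + 1),
        (∑ j ∈ Finset.range ((G.coeff i).natDegree + 1), algebraMap K ℂ ((G.coeff i).coeff j) * u y ^ j) *
          v y ^ i := by
    funext y
    rw [eval_map, eval₂_eq_sum_range]
    refine Finset.sum_congr rfl fun i _ => ?_
    rw [coe_eval₂RingHom, eval₂_eq_sum_range]
  rw [hfun]
  have inner : ∀ i, AnalyticAt ℝ (fun y => ∑ j ∈ Finset.range ((G.coeff i).natDegree + 1),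
      algebraMap K ℂ ((G.coeff i).coeff j) * u y ^ j) x := by
    intro i
    have h := Finset.analyticAt_sum (𝕜 := ℝ) (c := x) (Finset.range ((G.coeff i).natDegree + 1))
      (f := fun j y => algebraMap K ℂ ((G.coeff i).coeff j) * u y ^ j)
      (fun j _ => analyticAt_const.mul (hu.pow j))
    rwa [Finset.sum_fn] at h
  have h := Finset.analyticAt_sum (𝕜 := ℝ) (c := x) (Finset.range (G.natDegree + 1))
    (f := fun i y => (∑ j ∈ Finset.range ((G.coeff i).natDegree + 1),
      algebraMap K ℂ ((G.coeff i).coeff j) * u y ^ j) * v y ^ i)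
    (fun i _ => (inner i).mul (hv.pow i))
  rwa [Finset.sum_fn] at h

/-! ### An irreducible factor vanishing along an analytic real arc -/

/-- If a non-zero `Pk ∈ K[s][Y]` vanishes along the arc `x ↦ (x − a, f x)`, `x ∈ (a, b)`, with `f` real-analytic
on `(a, b)`, then so does one of its irreducible factors, which moreover has positive `Y`-degree. (Pointwise some
factor vanishes; the factor vanishing FREQUENTLY near the midpoint vanishes identically, by the identity
principle on the connected interval.) [folklore] -/
theorem exists_irreducible_factor_vanishing (Pk : K[X][X]) (hPk : Pk ≠ 0) {f : ℝ → ℝ} {a b : ℝ}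
    (hab : a < b) (hf : ∀ x ∈ Ioo a b, AnalyticAt ℝ f x)
    (hvan : ∀ x ∈ Ioo a b,
      (Pk.map (eval₂RingHom (algebraMap K ℂ) ((x : ℂ) - a))).eval ((f x : ℝ) : ℂ) = 0) :
    ∃ Q : K[X][X], Irreducible Q ∧ 0 < Q.natDegree ∧
      ∀ x ∈ Ioo a b, (Q.map (eval₂RingHom (algebraMap K ℂ) ((x : ℂ) - a))).eval ((f x : ℝ) : ℂ) = 0 := by
  classical
  -- evaluation along the arc, as a ring homomorphism
  obtain ⟨E, hE⟩ : ∃ E : ℝ → (K[X][X] →+* ℂ), ∀ x, E x =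
      eval₂RingHom (eval₂RingHom (algebraMap K ℂ) ((x : ℂ) - a)) ((f x : ℝ) : ℂ) := ⟨_, fun _ => rfl⟩
  have hEval : ∀ (G : K[X][X]) (x : ℝ),
      (G.map (eval₂RingHom (algebraMap K ℂ) ((x : ℂ) - a))).eval ((f x : ℝ) : ℂ) = E x G := by
    intro G x
    rw [hE, eval_map]
    rfl
  have hEC : ∀ (x : ℝ) (c : K), E x (C (C c)) = algebraMap K ℂ c := by
    intro x c
    rw [hE, coe_eval₂RingHom, eval₂_C, coe_eval₂RingHom, eval₂_C]
  -- factorisation `Pk = (∏ factors) * unit`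
  obtain ⟨u, hu⟩ := UniqueFactorizationMonoid.factors_prod hPk
  have hunit : ∀ x, E x (u : K[X][X]) ≠ 0 := by
    intro x
    obtain ⟨r, hr, hru⟩ := Polynomial.isUnit_iff.1 u.isUnit
    obtain ⟨c, hc, hcr⟩ := Polynomial.isUnit_iff.1 hr
    rw [← hru, ← hcr, hEC]
    exact (map_ne_zero_iff _ (algebraMap K ℂ).injective).2 hc.ne_zero
  -- pointwise: some factor vanishes
  have hpt : ∀ x ∈ Ioo a b, ∃ q ∈ (UniqueFactorizationMonoid.factors Pk).toFinset, E x q = 0 := by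
    intro x hx
    have h0 : E x Pk = 0 := by rw [← hEval]; exact hvan x hx
    rw [← hu, map_mul, mul_eq_zero] at h0
    rcases h0 with h0 | h0
    · rw [map_multiset_prod, Multiset.prod_eq_zero_iff, Multiset.mem_map] at h0
      obtain ⟨q, hq, hq0⟩ := h0
      exact ⟨q, Multiset.mem_toFinset.2 hq, hq0⟩
    · exact absurd h0 (hunit x)
  -- near the midpoint some factor vanishes frequently, hence identically on `(a, b)`
  have hcmem : (a + b) / 2 ∈ Ioo a b := ⟨by linarith, by linarith⟩
  have hfreq : ∃ q ∈ (UniqueFactorizationMonoid.factors Pk).toFinset, ∃ᶠ x in 𝓝[≠] ((a + b) / 2), E x q = 0 := by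
    by_contra hno
    have hall : ∀ᶠ x in 𝓝[≠] ((a + b) / 2), ∀ q ∈ (UniqueFactorizationMonoid.factors Pk).toFinset, E x q ≠ 0 := by
      refine (Filter.eventually_all_finset _).2 fun q hq => ?_
      exact Filter.not_frequently.1 fun hfr => hno ⟨q, hq, hfr⟩
    have hIoo : ∀ᶠ x in 𝓝[≠] ((a + b) / 2), x ∈ Ioo a b :=
      mem_nhdsWithin_of_mem_nhds (isOpen_Ioo.mem_nhds hcmem)
    obtain ⟨x, hx1, hx2⟩ := (hall.and hIoo).exists
    obtain ⟨q, hq, hq0⟩ := hpt x hx2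
    exact hx1 q hq hq0
  obtain ⟨q, hq, hqfreq⟩ := hfreq
  have hqirr : Irreducible q :=
    UniqueFactorizationMonoid.irreducible_of_factor q (Multiset.mem_toFinset.1 hq)
  -- analyticity of `x ↦ E x q` on `(a, b)`
  have han : ∀ x ∈ Ioo a b, AnalyticAt ℝ (fun y => E y q) x := by
    intro x hx
    have h := analyticAt_eval₂ q (u := fun y : ℝ => (y : ℂ) - a) (v := fun y : ℝ => ((f y : ℝ) : ℂ)) (x := x)
      ((Complex.ofRealCLM.analyticAt x).sub analyticAt_const)
      ((Complex.ofRealCLM.analyticAt _).comp (hf x hx))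
    refine h.congr (Filter.Eventually.of_forall fun y => ?_)
    exact hEval q y
  have hzero : EqOn (fun y => E y q) 0 (Ioo a b) := by
    have hev : ∀ᶠ x in 𝓝 ((a + b) / 2), E x q = 0 :=
      (han _ hcmem).frequently_zero_iff_eventually_zero.1 hqfreq
    exact AnalyticOnNhd.eqOn_zero_of_preconnected_of_eventuallyEq_zero (fun x hx => han x hx)
      isPreconnected_Ioo hcmem hev
  -- positive degree: a non-zero "constant" `q ∈ K[s]` cannot vanish on an interval of abscissae
  have hdeg : 0 < q.natDegree := by
    rw [Nat.pos_iff_ne_zero]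
    intro hdeg0
    obtain ⟨r, hr⟩ := natDegree_eq_zero.1 hdeg0
    have hr0 : r ≠ 0 := by
      rintro rfl
      rw [C_0] at hr
      exact hqirr.ne_zero hr.symm
    -- `x ↦ r(x - a)` vanishes on `(a, b)`, so the polynomial `r` is zero
    have hrvan : ∀ x ∈ Ioo a b, (r.map (algebraMap K ℂ)).IsRoot ((x : ℂ) - a) := by
      intro x hx
      have h := hzero hx
      simp only [Pi.zero_apply] at h
      rw [← hr, hE, coe_eval₂RingHom, eval₂_C, coe_eval₂RingHom] at h
      rw [IsRoot.def, eval_map]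
      exact h
    haveI : Infinite (Ioo a b) := (Ioo_infinite hab).to_subtype
    have hrmap : r.map (algebraMap K ℂ) = 0 := by
      apply Polynomial.eq_zero_of_infinite_isRoot
      refine Set.infinite_of_injective_forall_mem (f := fun x : Ioo a b => ((x : ℝ) : ℂ) - a) ?_ ?_
      · intro x y hxy
        have : ((x : ℝ) : ℂ) = ((y : ℝ) : ℂ) := sub_left_injective hxy
        exact Subtype.ext (by exact_mod_cast this)
      · intro x
        exact hrvan x x.2
    exact hr0 ((Polynomial.map_eq_zero_iff (algebraMap K ℂ).injective).1 hrmap)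
  refine ⟨q, hqirr, hdeg, fun x hx => ?_⟩
  rw [hEval]
  exact hzero hx

/-- **Registered anchor `helper_puiseuxGerm_1`** (= `exists_irreducible_factor_vanishing` with `K : Type`): along
an analytic real arc a non-zero `Pk ∈ K[s][Y]` has an irreducible factor of positive `Y`-degree vanishing on the
whole arc. [folklore] -/
theorem helper_puiseuxGerm_1 : ∀ {K : Type} [Field K] [Algebra K ℂ] (Pk : Polynomial (Polynomial K)), Pk ≠ 0 → ∀ {f : ℝ → ℝ} {a b : ℝ}, a < b → (∀ x ∈ Set.Ioo a b, AnalyticAt ℝ f x) → (∀ x ∈ Set.Ioo a b, Polynomial.eval ((f x : ℝ) : ℂ) (Polynomial.map (Polynomial.eval₂RingHom (algebraMap K ℂ) ((x : ℂ) - a)) Pk) = 0) → ∃ Q : Polynomial (Polynomial K), Irreducible Q ∧ 0 < Q.natDegree ∧ ∀ x ∈ Set.Ioo a b, Polynomial.eval ((f x : ℝ) : ℂ) (Polynomial.map (Polynomial.eval₂RingHom (algebraMap K ℂ) ((x : ℂ) - a)) Q) = 0 :=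
  fun Pk hPk _ _ _ hab hf hvan => exists_irreducible_factor_vanishing Pk hPk hab hf hvan

end PuiseuxGerm

end Summit.KontsevichZagierPeriods.SymplecticScissors.RealOnePeriodRelations

end
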